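import Summits.CriticalPhenomena.PercolationContinuityZ3.Theorems.PercNearOneGluingNoHeavyLowerTailMajorityGluingHubOnly
import Summits.CriticalPhenomena.PercolationContinuityZ3.Theorems.PercNearOneGluingNoHeavyLowerTailMajorityGluingSixAbstract
import Summits.CriticalPhenomena.PercolationContinuityZ3.Theorems.PercNearOneGluingAdditiveGluingKnThm2GoodEvents
import Literature.Probability.Percolation.BergKahnLogSupermodular
import HarnessLib

/-!
# Majority gluing at `|A| = 6`: loss `(499/243)·max` from van den Berg–Kahn log-supermodularity
# (lane prim-rate, constants-miner 1, row M1-V6; improves the tree's `7/3` for `|A| = 6`)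

Support file for the closed crux `NoHeavyLowerTail` (stmt-CriticalPhenomena-4575), continuing
`PercNearOneGluingNoHeavyLowerTailMajorityGluingHubOnly.lean` (hub-only reduction `HubOnly.majorityGluing_of_hubOnly`) and
`PercNearOneGluingNoHeavyLowerTailMajorityGluing.lean` (loss `(1 + (|A|−2)/⌈|A|/2⌉)·max`, i.e. `7/3·max` at `|A| = 6`).

THE INPUT.  van den Berg–Kahn (2001), Theorem 1.2 with `A = B = ∅` — in the tree as `BergKahn.bergKahn_avoidance`: the avoidance
probabilities `f(X) = P(a₀ ↛ X)` of bond percolation are log-supermodular, `f(X) f(Y) ≤ f(X ∩ Y) f(X ∪ Y)`.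
THE ABSTRACT STEP (`threeOfFour_abstract`, `threeOfFour_sym`).  For four relays with `f({b}) ≤ δ`, log-supermodularity alone gives
`P(at least 3 of the 4 are cut from a₀) = Σ_{|S|=3} f(S) − 3 f(B) ≤ (256/243)·δ` (`threeOfFour_cut`); the constant `256/243` is the exact value
of the abstract optimisation (attained by the log-modular law 'trigger w.p. `9δ/8`, then independent cuts w.p. `8/9`'), so `1·δ` — the miner's
conjectured percolation Erdős–Ko–Rado bound (row M1-E1) — needs more than log-supermodularity.
THE CONSEQUENCE (`majorityGluing_vdBK_card_six`).  For `|A| = 6` every hub event satisfies `μ(H_a) ≤ max + μ(≥ 3 of 4 others cut) ≤ (499/243)·max`,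
hence majority gluing `μ(o ↔ a₀ ∧ 2N > 6) ≥ μ(o ↔ A) − (499/243)·max_{a∈A} μ(a ↮ a₀)` for every observer and weight function
(`499/243 ≈ 2.0535 < 7/3`; conjecture: `2`).  No definitions, no named facts, no sorries.
[cite: VandenbergKahn2001, Thm 1.2 (p. 123)] [cite: KozmaNitzan2024, Conj. 1 (p. 3), Conj. 4 (p. 32)]
-/

noncomputable section

namespace Summit.CriticalPhenomena.PercolationContinuityZ3.Theorems

open MeasureTheory Set
open Literature.Probability.LatticeModels (prodBernoulli)
open Literature.Probability.Percolation
open scoped Classical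

namespace HubOnly

variable {n : ℕ}

/-! ### The percolation three-of-four bound from log-supermodularity -/

/-- Avoidance probabilities are antitone in the avoided set. [folklore] -/
theorem avoid_real_anti (w : Sym2 (Fin n) → unitInterval) (a₀ : Fin n) {X Y : Set (Fin n)} (h : X ⊆ Y) :
    (prodBernoulli w).real {ω : BondConfig (Fin n) | ∀ x ∈ Y, ω ∉ openConn a₀ x} ≤
      (prodBernoulli w).real {ω : BondConfig (Fin n) | ∀ x ∈ X, ω ∉ openConn a₀ x} :=
  measureReal_mono (fun _ hω x hx => hω x (h hx))

/-- van den Berg–Kahn log-supermodularity of the avoidance probabilities, relaxed along inclusions: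
`P(a₀ ↛ X) P(a₀ ↛ Y) ≤ P(a₀ ↛ X') P(a₀ ↛ Y')` for `X' ⊆ X ∩ Y`, `Y' ⊆ X ∪ Y`. [cite: VandenbergKahn2001, Thm 1.2 (p. 123)] -/
theorem avoid_real_bk (w : Sym2 (Fin n) → unitInterval) (a₀ : Fin n) (X Y X' Y' : Set (Fin n))
    (h1 : X' ⊆ X ∩ Y) (h2 : Y' ⊆ X ∪ Y) :
    (prodBernoulli w).real {ω : BondConfig (Fin n) | ∀ x ∈ X, ω ∉ openConn a₀ x} *
        (prodBernoulli w).real {ω : BondConfig (Fin n) | ∀ x ∈ Y, ω ∉ openConn a₀ x} ≤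
      (prodBernoulli w).real {ω : BondConfig (Fin n) | ∀ x ∈ X', ω ∉ openConn a₀ x} *
        (prodBernoulli w).real {ω : BondConfig (Fin n) | ∀ x ∈ Y', ω ∉ openConn a₀ x} :=
  (BergKahn.bergKahn_avoidance w a₀ X Y).trans
    (mul_le_mul (avoid_real_anti w a₀ h1) (avoid_real_anti w a₀ h2) measureReal_nonneg measureReal_nonneg)

/-- A single avoided vertex: `{a₀ ↛ {b}} = {a₀ ↔ b}ᶜ`. [folklore] -/
theorem avoid_single (a₀ b : Fin n) :
    {ω : BondConfig (Fin n) | ∀ x ∈ ({b} : Set (Fin n)), ω ∉ openConn a₀ x} = (openConn a₀ b : Set (BondConfig (Fin n)))ᶜ := by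
  ext ω; simp

/-- Splitting an avoidance probability along a larger avoided set: `P(a₀ ↛ X) = P(a₀ ↛ B) + P({a₀ ↛ X} ∖ {a₀ ↛ B})` for `X ⊆ B`. [folklore] -/
theorem avoid_real_split (w : Sym2 (Fin n) → unitInterval) (a₀ : Fin n) {X B : Set (Fin n)} (h : X ⊆ B) :
    (prodBernoulli w).real {ω : BondConfig (Fin n) | ∀ x ∈ X, ω ∉ openConn a₀ x} =
      (prodBernoulli w).real {ω : BondConfig (Fin n) | ∀ x ∈ B, ω ∉ openConn a₀ x} +
      (prodBernoulli w).real ({ω : BondConfig (Fin n) | ∀ x ∈ X, ω ∉ openConn a₀ x} \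
        {ω : BondConfig (Fin n) | ∀ x ∈ B, ω ∉ openConn a₀ x}) := by
  have hsub : {ω : BondConfig (Fin n) | ∀ x ∈ B, ω ∉ openConn a₀ x} ⊆ {ω : BondConfig (Fin n) | ∀ x ∈ X, ω ∉ openConn a₀ x} :=
    fun _ hω x hx => hω x (h hx)
  have hm := measureReal_inter_add_sdiff (μ := prodBernoulli w)
    (s := {ω : BondConfig (Fin n) | ∀ x ∈ X, ω ∉ openConn a₀ x})
    (t := {ω : BondConfig (Fin n) | ∀ x ∈ B, ω ∉ openConn a₀ x}) MeasurableSet.of_discrete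
  rw [Set.inter_eq_right.2 hsub] at hm
  linarith

/-- **Three of four relays cut from the hub: `P ≤ (256/243)·max_i P(bᵢ ↮ a₀)`** — from van den Berg–Kahn log-supermodularity of the
avoidance probabilities (`BergKahn.bergKahn_avoidance`) and the abstract bound `threeOfFour_sym`.  The event is written as the union over
the four triples `S` of `{a₀ ↛ S}`. [cite: VandenbergKahn2001, Thm 1.2 (p. 123)] -/
theorem threeOfFour_cut (w : Sym2 (Fin n) → unitInterval) (a₀ b₁ b₂ b₃ b₄ : Fin n) (δ : ℝ)
    (h₁ : (prodBernoulli w).real (openConn a₀ b₁ : Set (BondConfig (Fin n)))ᶜ ≤ δ)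
    (h₂ : (prodBernoulli w).real (openConn a₀ b₂ : Set (BondConfig (Fin n)))ᶜ ≤ δ)
    (h₃ : (prodBernoulli w).real (openConn a₀ b₃ : Set (BondConfig (Fin n)))ᶜ ≤ δ)
    (h₄ : (prodBernoulli w).real (openConn a₀ b₄ : Set (BondConfig (Fin n)))ᶜ ≤ δ) :
    (prodBernoulli w).real
        ({ω : BondConfig (Fin n) | ∀ x ∈ ({b₂, b₃, b₄} : Set (Fin n)), ω ∉ openConn a₀ x} ∪
          {ω : BondConfig (Fin n) | ∀ x ∈ ({b₁, b₃, b₄} : Set (Fin n)), ω ∉ openConn a₀ x} ∪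
          {ω : BondConfig (Fin n) | ∀ x ∈ ({b₁, b₂, b₄} : Set (Fin n)), ω ∉ openConn a₀ x} ∪
          {ω : BondConfig (Fin n) | ∀ x ∈ ({b₁, b₂, b₃} : Set (Fin n)), ω ∉ openConn a₀ x}) ≤ 256 / 243 * δ := by
  have hd : ∀ b : Fin n, (prodBernoulli w).real (openConn a₀ b : Set (BondConfig (Fin n)))ᶜ ≤ δ →
      (prodBernoulli w).real {ω : BondConfig (Fin n) | ∀ x ∈ ({b} : Set (Fin n)), ω ∉ openConn a₀ x} ≤ δ := by
    intro b hb; rw [avoid_single]; exact hb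
  have nn : ∀ X : Set (Fin n), 0 ≤ (prodBernoulli w).real {ω : BondConfig (Fin n) | ∀ x ∈ X, ω ∉ openConn a₀ x} :=
    fun _ => measureReal_nonneg
  -- q ≤ t_i
  have hq1 := avoid_real_anti w a₀ (show ({b₂, b₃, b₄} : Set (Fin n)) ⊆ ({b₁, b₂, b₃, b₄} : Set (Fin n)) from (by intro x hx; simp only [mem_insert_iff, mem_singleton_iff] at hx ⊢; tauto))
  have hq2 := avoid_real_anti w a₀ (show ({b₁, b₃, b₄} : Set (Fin n)) ⊆ ({b₁, b₂, b₃, b₄} : Set (Fin n)) from (by intro x hx; simp only [mem_insert_iff, mem_singleton_iff] at hx ⊢; tauto))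
  have hq3 := avoid_real_anti w a₀ (show ({b₁, b₂, b₄} : Set (Fin n)) ⊆ ({b₁, b₂, b₃, b₄} : Set (Fin n)) from (by intro x hx; simp only [mem_insert_iff, mem_singleton_iff] at hx ⊢; tauto))
  have hq4 := avoid_real_anti w a₀ (show ({b₁, b₂, b₃} : Set (Fin n)) ⊆ ({b₁, b₂, b₃, b₄} : Set (Fin n)) from (by intro x hx; simp only [mem_insert_iff, mem_singleton_iff] at hx ⊢; tauto))
  -- t_i ≤ p for the pairs inside the triple i
  have h1a := avoid_real_anti w a₀ (show ({b₂, b₃} : Set (Fin n)) ⊆ ({b₂, b₃, b₄} : Set (Fin n)) from (by intro x hx; simp only [mem_insert_iff, mem_singleton_iff] at hx ⊢; tauto))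
  have h1b := avoid_real_anti w a₀ (show ({b₂, b₄} : Set (Fin n)) ⊆ ({b₂, b₃, b₄} : Set (Fin n)) from (by intro x hx; simp only [mem_insert_iff, mem_singleton_iff] at hx ⊢; tauto))
  have h1c := avoid_real_anti w a₀ (show ({b₃, b₄} : Set (Fin n)) ⊆ ({b₂, b₃, b₄} : Set (Fin n)) from (by intro x hx; simp only [mem_insert_iff, mem_singleton_iff] at hx ⊢; tauto))
  have h2a := avoid_real_anti w a₀ (show ({b₁, b₃} : Set (Fin n)) ⊆ ({b₁, b₃, b₄} : Set (Fin n)) from (by intro x hx; simp only [mem_insert_iff, mem_singleton_iff] at hx ⊢; tauto))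
  have h2b := avoid_real_anti w a₀ (show ({b₁, b₄} : Set (Fin n)) ⊆ ({b₁, b₃, b₄} : Set (Fin n)) from (by intro x hx; simp only [mem_insert_iff, mem_singleton_iff] at hx ⊢; tauto))
  have h2c := avoid_real_anti w a₀ (show ({b₃, b₄} : Set (Fin n)) ⊆ ({b₁, b₃, b₄} : Set (Fin n)) from (by intro x hx; simp only [mem_insert_iff, mem_singleton_iff] at hx ⊢; tauto))
  have h3a := avoid_real_anti w a₀ (show ({b₁, b₂} : Set (Fin n)) ⊆ ({b₁, b₂, b₄} : Set (Fin n)) from (by intro x hx; simp only [mem_insert_iff, mem_singleton_iff] at hx ⊢; tauto))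
  have h3b := avoid_real_anti w a₀ (show ({b₁, b₄} : Set (Fin n)) ⊆ ({b₁, b₂, b₄} : Set (Fin n)) from (by intro x hx; simp only [mem_insert_iff, mem_singleton_iff] at hx ⊢; tauto))
  have h3c := avoid_real_anti w a₀ (show ({b₂, b₄} : Set (Fin n)) ⊆ ({b₁, b₂, b₄} : Set (Fin n)) from (by intro x hx; simp only [mem_insert_iff, mem_singleton_iff] at hx ⊢; tauto))
  have h4a := avoid_real_anti w a₀ (show ({b₁, b₂} : Set (Fin n)) ⊆ ({b₁, b₂, b₃} : Set (Fin n)) from (by intro x hx; simp only [mem_insert_iff, mem_singleton_iff] at hx ⊢; tauto))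
  have h4b := avoid_real_anti w a₀ (show ({b₁, b₃} : Set (Fin n)) ⊆ ({b₁, b₂, b₃} : Set (Fin n)) from (by intro x hx; simp only [mem_insert_iff, mem_singleton_iff] at hx ⊢; tauto))
  have h4c := avoid_real_anti w a₀ (show ({b₂, b₃} : Set (Fin n)) ⊆ ({b₁, b₂, b₃} : Set (Fin n)) from (by intro x hx; simp only [mem_insert_iff, mem_singleton_iff] at hx ⊢; tauto))
  -- p ≤ δ
  have d12 := (avoid_real_anti w a₀ (show ({b₁} : Set (Fin n)) ⊆ ({b₁, b₂} : Set (Fin n)) from (by intro x hx; simp only [mem_insert_iff, mem_singleton_iff] at hx ⊢; tauto))).trans (hd b₁ h₁)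
  have d13 := (avoid_real_anti w a₀ (show ({b₁} : Set (Fin n)) ⊆ ({b₁, b₃} : Set (Fin n)) from (by intro x hx; simp only [mem_insert_iff, mem_singleton_iff] at hx ⊢; tauto))).trans (hd b₁ h₁)
  have d14 := (avoid_real_anti w a₀ (show ({b₁} : Set (Fin n)) ⊆ ({b₁, b₄} : Set (Fin n)) from (by intro x hx; simp only [mem_insert_iff, mem_singleton_iff] at hx ⊢; tauto))).trans (hd b₁ h₁)
  have d23 := (avoid_real_anti w a₀ (show ({b₂} : Set (Fin n)) ⊆ ({b₂, b₃} : Set (Fin n)) from (by intro x hx; simp only [mem_insert_iff, mem_singleton_iff] at hx ⊢; tauto))).trans (hd b₂ h₂)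
  have d24 := (avoid_real_anti w a₀ (show ({b₂} : Set (Fin n)) ⊆ ({b₂, b₄} : Set (Fin n)) from (by intro x hx; simp only [mem_insert_iff, mem_singleton_iff] at hx ⊢; tauto))).trans (hd b₂ h₂)
  have d34 := (avoid_real_anti w a₀ (show ({b₃} : Set (Fin n)) ⊆ ({b₃, b₄} : Set (Fin n)) from (by intro x hx; simp only [mem_insert_iff, mem_singleton_iff] at hx ⊢; tauto))).trans (hd b₃ h₃)
  -- (A): pairs of triples
  have A12 := avoid_real_bk w a₀ ({b₂, b₃, b₄} : Set (Fin n)) ({b₁, b₃, b₄} : Set (Fin n)) ({b₃, b₄} : Set (Fin n)) ({b₁, b₂, b₃, b₄} : Set (Fin n)) (by intro x hx; simp only [mem_insert_iff, mem_singleton_iff, mem_inter_iff] at hx ⊢; tauto) (by intro x hx; simp only [mem_insert_iff, mem_singleton_iff, mem_union] at hx ⊢; tauto)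
  have A13 := avoid_real_bk w a₀ ({b₂, b₃, b₄} : Set (Fin n)) ({b₁, b₂, b₄} : Set (Fin n)) ({b₂, b₄} : Set (Fin n)) ({b₁, b₂, b₃, b₄} : Set (Fin n)) (by intro x hx; simp only [mem_insert_iff, mem_singleton_iff, mem_inter_iff] at hx ⊢; tauto) (by intro x hx; simp only [mem_insert_iff, mem_singleton_iff, mem_union] at hx ⊢; tauto)
  have A14 := avoid_real_bk w a₀ ({b₂, b₃, b₄} : Set (Fin n)) ({b₁, b₂, b₃} : Set (Fin n)) ({b₂, b₃} : Set (Fin n)) ({b₁, b₂, b₃, b₄} : Set (Fin n)) (by intro x hx; simp only [mem_insert_iff, mem_singleton_iff, mem_inter_iff] at hx ⊢; tauto) (by intro x hx; simp only [mem_insert_iff, mem_singleton_iff, mem_union] at hx ⊢; tauto)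
  have A23 := avoid_real_bk w a₀ ({b₁, b₃, b₄} : Set (Fin n)) ({b₁, b₂, b₄} : Set (Fin n)) ({b₁, b₄} : Set (Fin n)) ({b₁, b₂, b₃, b₄} : Set (Fin n)) (by intro x hx; simp only [mem_insert_iff, mem_singleton_iff, mem_inter_iff] at hx ⊢; tauto) (by intro x hx; simp only [mem_insert_iff, mem_singleton_iff, mem_union] at hx ⊢; tauto)
  have A24 := avoid_real_bk w a₀ ({b₁, b₃, b₄} : Set (Fin n)) ({b₁, b₂, b₃} : Set (Fin n)) ({b₁, b₃} : Set (Fin n)) ({b₁, b₂, b₃, b₄} : Set (Fin n)) (by intro x hx; simp only [mem_insert_iff, mem_singleton_iff, mem_inter_iff] at hx ⊢; tauto) (by intro x hx; simp only [mem_insert_iff, mem_singleton_iff, mem_union] at hx ⊢; tauto)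
  have A34 := avoid_real_bk w a₀ ({b₁, b₂, b₄} : Set (Fin n)) ({b₁, b₂, b₃} : Set (Fin n)) ({b₁, b₂} : Set (Fin n)) ({b₁, b₂, b₃, b₄} : Set (Fin n)) (by intro x hx; simp only [mem_insert_iff, mem_singleton_iff, mem_inter_iff] at hx ⊢; tauto) (by intro x hx; simp only [mem_insert_iff, mem_singleton_iff, mem_union] at hx ⊢; tauto)
  -- (B): pairs inside a triple
  have B1a := (avoid_real_bk w a₀ ({b₂, b₃} : Set (Fin n)) ({b₂, b₄} : Set (Fin n)) ({b₂} : Set (Fin n)) ({b₂, b₃, b₄} : Set (Fin n)) (by intro x hx; simp only [mem_insert_iff, mem_singleton_iff, mem_inter_iff] at hx ⊢; tauto) (by intro x hx; simp only [mem_insert_iff, mem_singleton_iff, mem_union] at hx ⊢; tauto)).trans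
    (mul_le_mul_of_nonneg_right (hd b₂ h₂) (nn _))
  have B1b := (avoid_real_bk w a₀ ({b₂, b₃} : Set (Fin n)) ({b₃, b₄} : Set (Fin n)) ({b₃} : Set (Fin n)) ({b₂, b₃, b₄} : Set (Fin n)) (by intro x hx; simp only [mem_insert_iff, mem_singleton_iff, mem_inter_iff] at hx ⊢; tauto) (by intro x hx; simp only [mem_insert_iff, mem_singleton_iff, mem_union] at hx ⊢; tauto)).trans
    (mul_le_mul_of_nonneg_right (hd b₃ h₃) (nn _))
  have B1c := (avoid_real_bk w a₀ ({b₂, b₄} : Set (Fin n)) ({b₃, b₄} : Set (Fin n)) ({b₄} : Set (Fin n)) ({b₂, b₃, b₄} : Set (Fin n)) (by intro x hx; simp only [mem_insert_iff, mem_singleton_iff, mem_inter_iff] at hx ⊢; tauto) (by intro x hx; simp only [mem_insert_iff, mem_singleton_iff, mem_union] at hx ⊢; tauto)).trans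
    (mul_le_mul_of_nonneg_right (hd b₄ h₄) (nn _))
  have B2a := (avoid_real_bk w a₀ ({b₁, b₃} : Set (Fin n)) ({b₁, b₄} : Set (Fin n)) ({b₁} : Set (Fin n)) ({b₁, b₃, b₄} : Set (Fin n)) (by intro x hx; simp only [mem_insert_iff, mem_singleton_iff, mem_inter_iff] at hx ⊢; tauto) (by intro x hx; simp only [mem_insert_iff, mem_singleton_iff, mem_union] at hx ⊢; tauto)).trans
    (mul_le_mul_of_nonneg_right (hd b₁ h₁) (nn _))
  have B2b := (avoid_real_bk w a₀ ({b₁, b₃} : Set (Fin n)) ({b₃, b₄} : Set (Fin n)) ({b₃} : Set (Fin n)) ({b₁, b₃, b₄} : Set (Fin n)) (by intro x hx; simp only [mem_insert_iff, mem_singleton_iff, mem_inter_iff] at hx ⊢; tauto) (by intro x hx; simp only [mem_insert_iff, mem_singleton_iff, mem_union] at hx ⊢; tauto)).trans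
    (mul_le_mul_of_nonneg_right (hd b₃ h₃) (nn _))
  have B2c := (avoid_real_bk w a₀ ({b₁, b₄} : Set (Fin n)) ({b₃, b₄} : Set (Fin n)) ({b₄} : Set (Fin n)) ({b₁, b₃, b₄} : Set (Fin n)) (by intro x hx; simp only [mem_insert_iff, mem_singleton_iff, mem_inter_iff] at hx ⊢; tauto) (by intro x hx; simp only [mem_insert_iff, mem_singleton_iff, mem_union] at hx ⊢; tauto)).trans
    (mul_le_mul_of_nonneg_right (hd b₄ h₄) (nn _))
  have B3a := (avoid_real_bk w a₀ ({b₁, b₂} : Set (Fin n)) ({b₁, b₄} : Set (Fin n)) ({b₁} : Set (Fin n)) ({b₁, b₂, b₄} : Set (Fin n)) (by intro x hx; simp only [mem_insert_iff, mem_singleton_iff, mem_inter_iff] at hx ⊢; tauto) (by intro x hx; simp only [mem_insert_iff, mem_singleton_iff, mem_union] at hx ⊢; tauto)).trans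
    (mul_le_mul_of_nonneg_right (hd b₁ h₁) (nn _))
  have B3b := (avoid_real_bk w a₀ ({b₁, b₂} : Set (Fin n)) ({b₂, b₄} : Set (Fin n)) ({b₂} : Set (Fin n)) ({b₁, b₂, b₄} : Set (Fin n)) (by intro x hx; simp only [mem_insert_iff, mem_singleton_iff, mem_inter_iff] at hx ⊢; tauto) (by intro x hx; simp only [mem_insert_iff, mem_singleton_iff, mem_union] at hx ⊢; tauto)).trans
    (mul_le_mul_of_nonneg_right (hd b₂ h₂) (nn _))
  have B3c := (avoid_real_bk w a₀ ({b₁, b₄} : Set (Fin n)) ({b₂, b₄} : Set (Fin n)) ({b₄} : Set (Fin n)) ({b₁, b₂, b₄} : Set (Fin n)) (by intro x hx; simp only [mem_insert_iff, mem_singleton_iff, mem_inter_iff] at hx ⊢; tauto) (by intro x hx; simp only [mem_insert_iff, mem_singleton_iff, mem_union] at hx ⊢; tauto)).trans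
    (mul_le_mul_of_nonneg_right (hd b₄ h₄) (nn _))
  have B4a := (avoid_real_bk w a₀ ({b₁, b₂} : Set (Fin n)) ({b₁, b₃} : Set (Fin n)) ({b₁} : Set (Fin n)) ({b₁, b₂, b₃} : Set (Fin n)) (by intro x hx; simp only [mem_insert_iff, mem_singleton_iff, mem_inter_iff] at hx ⊢; tauto) (by intro x hx; simp only [mem_insert_iff, mem_singleton_iff, mem_union] at hx ⊢; tauto)).trans
    (mul_le_mul_of_nonneg_right (hd b₁ h₁) (nn _))
  have B4b := (avoid_real_bk w a₀ ({b₁, b₂} : Set (Fin n)) ({b₂, b₃} : Set (Fin n)) ({b₂} : Set (Fin n)) ({b₁, b₂, b₃} : Set (Fin n)) (by intro x hx; simp only [mem_insert_iff, mem_singleton_iff, mem_inter_iff] at hx ⊢; tauto) (by intro x hx; simp only [mem_insert_iff, mem_singleton_iff, mem_union] at hx ⊢; tauto)).trans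
    (mul_le_mul_of_nonneg_right (hd b₂ h₂) (nn _))
  have B4c := (avoid_real_bk w a₀ ({b₁, b₃} : Set (Fin n)) ({b₂, b₃} : Set (Fin n)) ({b₃} : Set (Fin n)) ({b₁, b₂, b₃} : Set (Fin n)) (by intro x hx; simp only [mem_insert_iff, mem_singleton_iff, mem_inter_iff] at hx ⊢; tauto) (by intro x hx; simp only [mem_insert_iff, mem_singleton_iff, mem_union] at hx ⊢; tauto)).trans
    (mul_le_mul_of_nonneg_right (hd b₃ h₃) (nn _))
  have key := threeOfFour_sym δ _ _ _ _ _ _ _ _ _ _ _ (nn _) hq1 hq2 hq3 hq4 h1a h1b h1c h2a h2b h2c h3a h3b h3c h4a h4b h4c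
    d12 d13 d14 d23 d24 d34 A12 A13 A14 A23 A24 A34 B1a B1b B1c B2a B2b B2c B3a B3b B3c B4a B4b B4c
  -- the union bound through `{a₀ ↛ B}`
  have e1 := avoid_real_split w a₀ (show ({b₂, b₃, b₄} : Set (Fin n)) ⊆ ({b₁, b₂, b₃, b₄} : Set (Fin n)) from (by intro x hx; simp only [mem_insert_iff, mem_singleton_iff] at hx ⊢; tauto))
  have e2 := avoid_real_split w a₀ (show ({b₁, b₃, b₄} : Set (Fin n)) ⊆ ({b₁, b₂, b₃, b₄} : Set (Fin n)) from (by intro x hx; simp only [mem_insert_iff, mem_singleton_iff] at hx ⊢; tauto))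
  have e3 := avoid_real_split w a₀ (show ({b₁, b₂, b₄} : Set (Fin n)) ⊆ ({b₁, b₂, b₃, b₄} : Set (Fin n)) from (by intro x hx; simp only [mem_insert_iff, mem_singleton_iff] at hx ⊢; tauto))
  have e4 := avoid_real_split w a₀ (show ({b₁, b₂, b₃} : Set (Fin n)) ⊆ ({b₁, b₂, b₃, b₄} : Set (Fin n)) from (by intro x hx; simp only [mem_insert_iff, mem_singleton_iff] at hx ⊢; tauto))
  have hcov : {ω : BondConfig (Fin n) | ∀ x ∈ ({b₂, b₃, b₄} : Set (Fin n)), ω ∉ openConn a₀ x} ∪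
      {ω : BondConfig (Fin n) | ∀ x ∈ ({b₁, b₃, b₄} : Set (Fin n)), ω ∉ openConn a₀ x} ∪
      {ω : BondConfig (Fin n) | ∀ x ∈ ({b₁, b₂, b₄} : Set (Fin n)), ω ∉ openConn a₀ x} ∪
      {ω : BondConfig (Fin n) | ∀ x ∈ ({b₁, b₂, b₃} : Set (Fin n)), ω ∉ openConn a₀ x} ⊆
      {ω : BondConfig (Fin n) | ∀ x ∈ ({b₁, b₂, b₃, b₄} : Set (Fin n)), ω ∉ openConn a₀ x} ∪ (({ω : BondConfig (Fin n) | ∀ x ∈ ({b₂, b₃, b₄} : Set (Fin n)), ω ∉ openConn a₀ x} \ {ω : BondConfig (Fin n) | ∀ x ∈ ({b₁, b₂, b₃, b₄} : Set (Fin n)), ω ∉ openConn a₀ x}) ∪ ({ω : BondConfig (Fin n) | ∀ x ∈ ({b₁, b₃, b₄} : Set (Fin n)), ω ∉ openConn a₀ x} \ {ω : BondConfig (Fin n) | ∀ x ∈ ({b₁, b₂, b₃, b₄} : Set (Fin n)), ω ∉ openConn a₀ x}) ∪ ({ω : BondConfig (Fin n) | ∀ x ∈ ({b₁, b₂, b₄}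 : Set (Fin n)), ω ∉ openConn a₀ x} \ {ω : BondConfig (Fin n) | ∀ x ∈ ({b₁, b₂, b₃, b₄} : Set (Fin n)), ω ∉ openConn a₀ x}) ∪ ({ω : BondConfig (Fin n) | ∀ x ∈ ({b₁, b₂, b₃} : Set (Fin n)), ω ∉ openConn a₀ x} \ {ω : BondConfig (Fin n) | ∀ x ∈ ({b₁, b₂, b₃, b₄} : Set (Fin n)), ω ∉ openConn a₀ x})) := by
    intro ω hω
    by_cases hb : ω ∈ {ω : BondConfig (Fin n) | ∀ x ∈ ({b₁, b₂, b₃, b₄} : Set (Fin n)), ω ∉ openConn a₀ x}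
    · exact Or.inl hb
    · right
      rcases hω with ((h | h) | h) | h
      · exact Or.inl (Or.inl (Or.inl ⟨h, hb⟩))
      · exact Or.inl (Or.inl (Or.inr ⟨h, hb⟩))
      · exact Or.inl (Or.inr ⟨h, hb⟩)
      · exact Or.inr ⟨h, hb⟩
  have u0 := measureReal_mono (μ := prodBernoulli w) hcov
  have u1 := measureReal_union_le (μ := prodBernoulli w) {ω : BondConfig (Fin n) | ∀ x ∈ ({b₁, b₂, b₃, b₄} : Set (Fin n)), ω ∉ openConn a₀ x} (({ω : BondConfig (Fin n) | ∀ x ∈ ({b₂, b₃, b₄} : Set (Fin n)), ω ∉ openConn a₀ x} \ {ω : BondConfig (Fin n) | ∀ x ∈ ({b₁, b₂, b₃, b₄} : Set (Fin n)), ω ∉ openConn a₀ x}) ∪ ({ω : BondConfig (Fin n) | ∀ x ∈ ({b₁, b₃, b₄} : Set (Fin n)), ω ∉ openConn a₀ x} \ {ω : BondConfig (Fin n) | ∀ x ∈ ({b₁, b₂, b₃, b₄} : Set (Fin n)), ω ∉ openConn a₀ x}) ∪ ({ω : BondConfig (Fin n) | ∀ x ∈ ({b₁, b₂, b₄} : Set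 (Fin n)), ω ∉ openConn a₀ x} \ {ω : BondConfig (Fin n) | ∀ x ∈ ({b₁, b₂, b₃, b₄} : Set (Fin n)), ω ∉ openConn a₀ x}) ∪ ({ω : BondConfig (Fin n) | ∀ x ∈ ({b₁, b₂, b₃} : Set (Fin n)), ω ∉ openConn a₀ x} \ {ω : BondConfig (Fin n) | ∀ x ∈ ({b₁, b₂, b₃, b₄} : Set (Fin n)), ω ∉ openConn a₀ x}))
  have u2 := measureReal_union_le (μ := prodBernoulli w) (({ω : BondConfig (Fin n) | ∀ x ∈ ({b₂, b₃, b₄} : Set (Fin n)), ω ∉ openConn a₀ x} \ {ω : BondConfig (Fin n) | ∀ x ∈ ({b₁, b₂, b₃, b₄} : Set (Fin n)), ω ∉ openConn a₀ x}) ∪ ({ω : BondConfig (Fin n) | ∀ x ∈ ({b₁, b₃, b₄} : Set (Fin n)), ω ∉ openConn a₀ x} \ {ω : BondConfig (Fin n) | ∀ x ∈ ({b₁, b₂, b₃, b₄} : Set (Fin n)), ω ∉ openConn a₀ x}) ∪ ({ω : BondConfig (Fin n) | ∀ x ∈ ({b₁, b₂, b₄} : Set (Fin n)), ω ∉ openConn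 a₀ x} \ {ω : BondConfig (Fin n) | ∀ x ∈ ({b₁, b₂, b₃, b₄} : Set (Fin n)), ω ∉ openConn a₀ x})) ({ω : BondConfig (Fin n) | ∀ x ∈ ({b₁, b₂, b₃} : Set (Fin n)), ω ∉ openConn a₀ x} \ {ω : BondConfig (Fin n) | ∀ x ∈ ({b₁, b₂, b₃, b₄} : Set (Fin n)), ω ∉ openConn a₀ x})
  have u3 := measureReal_union_le (μ := prodBernoulli w) (({ω : BondConfig (Fin n) | ∀ x ∈ ({b₂, b₃, b₄} : Set (Fin n)), ω ∉ openConn a₀ x} \ {ω : BondConfig (Fin n) | ∀ x ∈ ({b₁, b₂, b₃, b₄} : Set (Fin n)), ω ∉ openConn a₀ x}) ∪ ({ω : BondConfig (Fin n) | ∀ x ∈ ({b₁, b₃, b₄} : Set (Fin n)), ω ∉ openConn a₀ x} \ {ω : BondConfig (Fin n) | ∀ x ∈ ({b₁, b₂, b₃, b₄} : Set (Fin n)), ω ∉ openConn a₀ x})) ({ω : BondConfig (Fin n) | ∀ x ∈ ({b₁, b₂, b₄} : Set (Fin n)), ω ∉ openConn a₀ x} \ {ω : BondConfig (Fin n) |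 ∀ x ∈ ({b₁, b₂, b₃, b₄} : Set (Fin n)), ω ∉ openConn a₀ x})
  have u4 := measureReal_union_le (μ := prodBernoulli w) ({ω : BondConfig (Fin n) | ∀ x ∈ ({b₂, b₃, b₄} : Set (Fin n)), ω ∉ openConn a₀ x} \ {ω : BondConfig (Fin n) | ∀ x ∈ ({b₁, b₂, b₃, b₄} : Set (Fin n)), ω ∉ openConn a₀ x}) ({ω : BondConfig (Fin n) | ∀ x ∈ ({b₁, b₃, b₄} : Set (Fin n)), ω ∉ openConn a₀ x} \ {ω : BondConfig (Fin n) | ∀ x ∈ ({b₁, b₂, b₃, b₄} : Set (Fin n)), ω ∉ openConn a₀ x})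
  linarith

/-! ### `|A| = 6`: loss `(499/243)·max` -/

/-- **At least three of four relays cut: `μ ≤ (256/243)·δ`**, counting form over a 4-element finset (hub-second orientation `v ↮ a₀`).
[cite: VandenbergKahn2001, Thm 1.2 (p. 123)] -/
theorem threeOfFour_count (w : Sym2 (Fin n) → unitInterval) (a₀ : Fin n) (T : Finset (Fin n)) (hT : T.card = 4) (δ : ℝ)
    (hδ : ∀ v ∈ T, (prodBernoulli w).real (openConn v a₀ : Set (BondConfig (Fin n)))ᶜ ≤ δ) :
    (prodBernoulli w).real {ω : BondConfig (Fin n) | 3 ≤ (T.filter fun v => ω ∉ openConn v a₀).card} ≤ 256 / 243 * δ := by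
  obtain ⟨b₁, T', hb₁T', hTins, hT'⟩ := Finset.card_eq_succ.1 hT
  obtain ⟨b₂, b₃, b₄, h23, h24, h34, hT'eq⟩ := Finset.card_eq_three.1 hT'
  have hmem : ∀ v, v ∈ T ↔ v = b₁ ∨ v = b₂ ∨ v = b₃ ∨ v = b₄ := by
    intro v; rw [← hTins, hT'eq]; simp
  have h12 : b₁ ≠ b₂ := by rintro rfl; exact hb₁T' (by rw [hT'eq]; simp)
  have h13 : b₁ ≠ b₃ := by rintro rfl; exact hb₁T' (by rw [hT'eq]; simp)
  have h14 : b₁ ≠ b₄ := by rintro rfl; exact hb₁T' (by rw [hT'eq]; simp)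
  have hd : ∀ b, b ∈ T → (prodBernoulli w).real (openConn a₀ b : Set (BondConfig (Fin n)))ᶜ ≤ δ := by
    intro b hb; rw [knThm2_openConn_comm]; exact hδ b hb
  have hb1 : b₁ ∈ T := (hmem b₁).2 (Or.inl rfl)
  have hb2 : b₂ ∈ T := (hmem b₂).2 (Or.inr (Or.inl rfl))
  have hb3 : b₃ ∈ T := (hmem b₃).2 (Or.inr (Or.inr (Or.inl rfl)))
  have hb4 : b₄ ∈ T := (hmem b₄).2 (Or.inr (Or.inr (Or.inr rfl)))
  refine le_trans (measureReal_mono ?_) (threeOfFour_cut w a₀ b₁ b₂ b₃ b₄ δ (hd _ hb1) (hd _ hb2) (hd _ hb3) (hd _ hb4))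
  intro ω hω
  simp only [mem_setOf_eq] at hω
  -- two distinct un-cut relays contradict the count
  have key : ∀ u v, u ∈ T → v ∈ T → u ≠ v → ω ∈ openConn u a₀ → ω ∉ openConn v a₀ := by
    intro u v hu hv huv hcu hcv
    have hsplit := Finset.card_filter_add_card_filter_not (s := T) (fun x => ω ∉ openConn x a₀)
    have h2 : 2 ≤ (T.filter fun x => ¬ ω ∉ openConn x a₀).card := by
      have hsub : ({u, v} : Finset (Fin n)) ⊆ T.filter fun x => ¬ ω ∉ openConn x a₀ := by
        intro y hy
        rcases Finset.mem_insert.1 hy with rfl | hy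
        · exact Finset.mem_filter.2 ⟨hu, not_not.2 hcu⟩
        · rw [Finset.mem_singleton.1 hy]; exact Finset.mem_filter.2 ⟨hv, not_not.2 hcv⟩
      have := Finset.card_le_card hsub
      rwa [Finset.card_pair huv] at this
    omega
  -- orientation
  have cut : ∀ v, ω ∉ openConn v a₀ → ω ∉ (openConn a₀ v : Set (BondConfig (Fin n))) := by
    intro v hv; rwa [knThm2_openConn_comm]
  by_cases c1 : ω ∈ openConn b₁ a₀
  · -- b₁ joined: b₂, b₃, b₄ cut
    left; left; left
    intro x hx
    simp only [mem_insert_iff, mem_singleton_iff] at hx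
    rcases hx with rfl | rfl | rfl
    · exact cut _ (key b₁ _ hb1 hb2 h12 c1)
    · exact cut _ (key b₁ _ hb1 hb3 h13 c1)
    · exact cut _ (key b₁ _ hb1 hb4 h14 c1)
  by_cases c2 : ω ∈ openConn b₂ a₀
  · left; left; right
    intro x hx
    simp only [mem_insert_iff, mem_singleton_iff] at hx
    rcases hx with rfl | rfl | rfl
    · exact cut _ c1
    · exact cut _ (key b₂ _ hb2 hb3 h23 c2)
    · exact cut _ (key b₂ _ hb2 hb4 h24 c2)
  by_cases c3 : ω ∈ openConn b₃ a₀
  · left; right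
    intro x hx
    simp only [mem_insert_iff, mem_singleton_iff] at hx
    rcases hx with rfl | rfl | rfl
    · exact cut _ c1
    · exact cut _ c2
    · exact cut _ (key b₃ _ hb3 hb4 h34 c3)
  · right
    intro x hx
    simp only [mem_insert_iff, mem_singleton_iff] at hx
    rcases hx with rfl | rfl | rfl
    · exact cut _ c1
    · exact cut _ c2
    · exact cut _ c3

/-- **MAJORITY GLUING AT `|A| = 6` WITH LOSS `(499/243)·max` (`≈ 2.0535·max`; the tree had `7/3`), unconditionally** — from van den
Berg–Kahn log-supermodularity through the hub-only reduction: for every weight function, observer `o`, hub `a₀ ∈ A`, `|A| = 6` and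
`δ₀ ≥ max_{a∈A} μ(a ↮ a₀)`:  `μ(o ↔ a₀ ∧ 2N > 6) ≥ μ(o ↔ A) − (499/243)·δ₀`.  Proof: for each `a ∈ A` there is `c ∈ A ∖ {a₀}` with
`H_a ⊆ {c ↮ a₀} ∪ {≥ 3 of the four relays A ∖ {a₀, c} cut}`, so `μ(H_a) ≤ max + (256/243)·max` (`threeOfFour_count`), and
`HubOnly.majorityGluing_of_hubOnly` closes over all weights. [cite: VandenbergKahn2001, Thm 1.2 (p. 123)] [cite: KozmaNitzan2024, Conj. 1 (p. 3)] -/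
theorem majorityGluing_vdBK_card_six (w : Sym2 (Fin n) → unitInterval) (A : Finset (Fin n)) (o a₀ : Fin n) (δ₀ : ℝ)
    (ha₀ : a₀ ∈ A) (hA : A.card = 6) (hδ₀ : ∀ a ∈ A, (prodBernoulli w).real (openConn a a₀ : Set (BondConfig (Fin n)))ᶜ ≤ δ₀) :
    (prodBernoulli w).real (⋃ a ∈ A, openConn o a) - 499 / 243 * δ₀ ≤
      (prodBernoulli w).real {ω : BondConfig (Fin n) | ω ∈ openConn o a₀ ∧
          A.card < 2 * (A.filter fun a => ω ∈ openConn o a).card} := by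
  have h := majorityGluing_of_hubOnly (n := n) (499 / 243) (by norm_num) A a₀ ha₀ ?_ w o δ₀ hδ₀
  · linarith
  intro p hp a ha
  set μ := prodBernoulli p with hμ
  set δ : Fin n → ℝ := fun x => μ.real (openConn x a₀ : Set (BondConfig (Fin n)))ᶜ with hδ
  set M := A.sup' ⟨a₀, ha₀⟩ δ with hM
  have hδle : ∀ x ∈ A, δ x ≤ M := fun x hx => Finset.le_sup' δ hx
  -- the auxiliary relay `c ≠ a₀`
  obtain ⟨c, hcA, hca₀, hca⟩ : ∃ c ∈ A, c ≠ a₀ ∧ (a ≠ a₀ → c = a) := by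
    by_cases haa : a = a₀
    · have hpos : 1 < A.card := by rw [hA]; norm_num
      obtain ⟨c, hc, hne⟩ := Finset.exists_mem_ne hpos a₀
      exact ⟨c, hc, hne, fun h => (h haa).elim⟩
    · exact ⟨a, ha, haa, fun _ => rfl⟩
  set T : Finset (Fin n) := (A.erase a₀).erase c with hT
  have hcT : c ∈ A.erase a₀ := Finset.mem_erase.2 ⟨hca₀, hcA⟩
  have hTcard : T.card = 4 := by
    rw [hT, Finset.card_erase_of_mem hcT, Finset.card_erase_of_mem ha₀, hA]
  have hTA : T ⊆ A := (Finset.erase_subset _ _).trans (Finset.erase_subset _ _)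
  -- `H_a ⊆ {c ↮ a₀} ∪ {≥ 3 of T cut}`
  have hsub : {ω : BondConfig (Fin n) | ω ∈ openConn a a₀ → 2 * (A.filter fun a' => ω ∈ openConn a' a₀).card ≤ A.card} ⊆
      (openConn c a₀ : Set (BondConfig (Fin n)))ᶜ ∪ {ω | 3 ≤ (T.filter fun v => ω ∉ openConn v a₀).card} := by
    intro ω hω
    by_cases hcc : ω ∈ openConn c a₀
    · right
      -- `a ↔ a₀`: either `a = c` (joined) or `a = a₀`
      have haa : ω ∈ openConn a a₀ := by
        by_cases h' : a = a₀
        · rw [h']; exact (SimpleGraph.Reachable.refl _ : (openGraph ω).Reachable a₀ a₀)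
        · rw [← hca h']; exact hcc
      have hle := hω haa
      rw [hA] at hle
      have hsplit := Finset.card_filter_add_card_filter_not (s := A) (fun a' => ω ∈ openConn a' a₀)
      rw [hA] at hsplit
      have hcut : (A.filter fun a' => ¬ ω ∈ openConn a' a₀) ⊆ T.filter fun v => ω ∉ openConn v a₀ := by
        intro x hx
        rw [Finset.mem_filter] at hx ⊢
        refine ⟨?_, hx.2⟩
        rw [hT, Finset.mem_erase, Finset.mem_erase]
        refine ⟨?_, ?_, hx.1⟩
        · rintro rfl; exact hx.2 hcc
        · rintro rfl; exact hx.2 (SimpleGraph.Reachable.refl _ : (openGraph ω).Reachable x x)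
      have hc := Finset.card_le_card hcut
      simp only [mem_setOf_eq]
      omega
    · left; exact hcc
  have h34 := threeOfFour_count p a₀ T hTcard M (fun v hv => hδle v (hTA hv))
  calc μ.real {ω : BondConfig (Fin n) | ω ∈ openConn a a₀ → 2 * (A.filter fun a' => ω ∈ openConn a' a₀).card ≤ A.card}
      ≤ μ.real ((openConn c a₀ : Set (BondConfig (Fin n)))ᶜ ∪ {ω | 3 ≤ (T.filter fun v => ω ∉ openConn v a₀).card}) :=
        measureReal_mono hsub
    _ ≤ μ.real (openConn c a₀ : Set (BondConfig (Fin n)))ᶜ + μ.real {ω : BondConfig (Fin n) | 3 ≤ (T.filter fun v => ω ∉ openConn v a₀).card} :=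
        measureReal_union_le _ _
    _ ≤ M + 256 / 243 * M := add_le_add (hδle c hcA) h34
    _ = 499 / 243 * M := by ring

end HubOnly

end Summit.CriticalPhenomena.PercolationContinuityZ3.Theorems

end
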